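import Mathlib
import HarnessLib
import Summits.Ventures.LatticeQCDFlow.Exactness.SUNMultiStepLeapfrogHMCErgodic
import Summits.Ventures.LatticeQCDFlow.Exactness.SU2LeapfrogHMC
import Literature.MathematicalPhysics.QuantumFieldTheory.Balaban1983to89.B10Eq18SigmaSU2Haar
import Literature.MathematicalPhysics.QuantumFieldTheory.Balaban1983to89.B10Eq18SigmaSU2Chart

/-!
# Multi-step leapfrog HMC on `SU(2)` lattice gauge fields in Pauli coordinates: the `nstep ≥ 2` kernel of `SU2LeapfrogHMC.lean` is exact, and uniformly ergodic for short trajectories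

HONEST FRAMING: exact (Metropolis-corrected) sampling algorithms for lattice gauge theory;
figures of merit are autocorrelation/cost numbers at stated couplings and volumes; no
continuum-physics claim.

Venture `LatticeQCDFlow` (cell pub-lqcd), topic `Exactness`, FANOUT row 9 (eng-latcore, the
engine `latflow.core.hmc.HMC(f, β, 'leapfrog').trajectory(τ, nstep)` on `SU(2)`, momenta
`P_l = i p_l·σ` with `p_l ∈ ℝ³`, drift `U_l ← exp(iε p_l·σ) U_l`).  NEW WORK of the cell over the tree
(`SUNMultiStepLeapfrogHMCErgodic.lean`: the `SU(N)` theorem in ANY linear coordinates of `𝔰𝔲(N)`;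
`SU2LeapfrogHMC.lean`, gen-13: the single-step `SU(2)` kernel `su2LeapfrogHMC` in Pauli coordinates,
`su2ExpDrift`, `su2Kinetic`, `su2MomentumLaw`, `su2GibbsLaw`); the Literature's Pauli coordinates
`su2Coord`, `expPauli` (`Balaban1983to89.B10Eq18SigmaSU2(Haar|Chart)`: linear, injective, onto `𝔰𝔲(2)`,
`expPauli A = exp (su2Coord A)`) are used BY NAME; nothing is cited as a fact.

* §1 `pauliCoordι` — `su2Coord` as a linear map `ℝ³ →ₗ M₂(ℂ)` (`_skew`, `_injective`, `_range`);
  **`sunExpDrift_pauliCoordι`** — the `SU(N)` drift factors in these coordinates ARE gen-13's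
  `su2ExpDrift`; `sunLeapfrogProposalN_pauli_one` — at `n = 1` the `SU(N)` proposal is gen-13's;
  `sunMomentumLaw_pauli` — the refresh laws agree (`rfl`).
* §2 **`su2LeapfrogHMCN ε κ hg S n`** — THE `SU(2)` KERNEL AT `nstep = n` (:= the `SU(N)` kernel in Pauli
  coordinates with kinetic term `κΣ|p_l|²`); **`su2LeapfrogHMCN_one`** — at `n = 1` it IS gen-13's
  `su2LeapfrogHMC ε κ hg S`; **`su2LeapfrogHMCN_invariant`** — exact at every `nstep`.
* §3 **`su2LeapfrogHMCN_uniformlyErgodic`** / **`su2LeapfrogHMCN_invariant_unique`** — for `ε > 0`,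
  `κ > 0`, `n ≥ 1`, a measurable increment bounded by `b ≥ 0` per link and `K_g`-Lipschitz in the matrix
  sup norm, a measurable action bounded by `s`, and `nε, (2n+1)b, K_g εn² ≤ s₂ := sunShortTrajThreshold
  pauliCoordι _`: `|μ₀K_nᵗ(A) − su2GibbsLaw S (A)| ≤ (1 − δ)^{⌊t/(k+1)⌋}` for EVERY initial law, and
  `su2GibbsLaw S` is the unique invariant probability law.

NOT CLAIMED: anything beyond the threshold (long trajectories; Mackenzie 1989); constants; that for
`N = 2` ONE step of the power suffices (gen-13's global chart `|A| < π` gives Doeblin in one step at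
`nstep = 1`; here only a power is asserted); floating point.
-/

noncomputable section

namespace Summit.Ventures.LatticeQCDFlow.Exactness

open MeasureTheory ProbabilityTheory ProbabilityTheory.Kernel Set Metric Function NormedSpace
open Literature.MathematicalPhysics.QuantumFieldTheory (haarProbability)
open Literature.MathematicalPhysics.QuantumFieldTheory.Balaban1983to89.B10Eq18SigmaSU2 (su2Coord su2Coord_mem_su su2Coord_injective exists_su2Coord_eq)
open Literature.MathematicalPhysics.QuantumFieldTheory.Balaban1983to89.B10Eq18SigmaSU2Haar (expPauli coe_expPauli)
open Literature.MathematicalPhysics.QuantumFieldTheory.Balaban1983to89.B10Eq18SigmaSU2Chart (su2Coord_add su2Coord_smul)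
open Literature.Algebra.Lie.CompactKillingForm (su mem_su_iff)
open scoped ENNReal Matrix Matrix.Norms.Operator NNReal

set_option backward.isDefEq.respectTransparency false

/-! ## §1 Pauli coordinates as a linear map; the dictionary with `SU2LeapfrogHMC.lean` -/

section Coords

/-- **The Pauli coordinates of `𝔰𝔲(2)` as a linear map** `ℝ³ → M₂(ℂ)`, `A ↦ i(A₁σ₁ + A₂σ₂ + A₃σ₃)`
(the Literature's `su2Coord`). -/
def pauliCoordι : EuclideanSpace ℝ (Fin 3) →ₗ[ℝ] Matrix (Fin 2) (Fin 2) ℂ where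
  toFun A := su2Coord A
  map_add' A B := by
    change su2Coord (⇑(A + B)) = su2Coord ⇑A + su2Coord ⇑B
    rw [WithLp.ofLp_add, su2Coord_add]
  map_smul' c A := by
    change su2Coord (⇑(c • A)) = (c : ℝ) • su2Coord ⇑A
    rw [WithLp.ofLp_smul, su2Coord_smul]

/-- Pointwise: `pauliCoordι A = su2Coord A`. -/
@[simp] theorem pauliCoordι_apply (A : EuclideanSpace ℝ (Fin 3)) : pauliCoordι A = su2Coord A := rfl

/-- The values are skew-Hermitian and traceless. -/
theorem pauliCoordι_skew (A : EuclideanSpace ℝ (Fin 3)) : (pauliCoordι A)ᴴ = -pauliCoordι A ∧ (pauliCoordι A).trace = 0 := by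
  have h := (mem_su_iff.1 (su2Coord_mem_su (⇑A)))
  exact ⟨h.1, h.2⟩

/-- `pauliCoordι` is injective. -/
theorem pauliCoordι_injective : Injective pauliCoordι := fun _ _ h =>
  WithLp.ofLp_injective 2 (su2Coord_injective h)

/-- `pauliCoordι` is onto the skew-Hermitian traceless matrices. -/
theorem pauliCoordι_range (X : Matrix (Fin 2) (Fin 2) ℂ) (hX : Xᴴ = -X) (hX0 : X.trace = 0) :
    X ∈ LinearMap.range pauliCoordι := by
  have hsu : X ∈ su (Fin 2) := mem_su_iff.2 ⟨hX, hX0⟩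
  obtain ⟨x, hx⟩ := exists_su2Coord_eq hsu
  exact ⟨WithLp.toLp 2 x, by rw [pauliCoordι_apply, WithLp.ofLp_toLp, hx]⟩

/-- `suExp` in Pauli coordinates is the Literature's `expPauli`. -/
theorem suExp_pauliCoordι (A : EuclideanSpace ℝ (Fin 3)) : suExp pauliCoordι pauliCoordι_skew A = expPauli A :=
  Subtype.ext rfl

variable {ι : Type*}

/-- **THE `SU(N)` DRIFT FACTORS IN PAULI COORDINATES ARE GEN-13's `su2ExpDrift`.** -/
theorem sunExpDrift_pauliCoordι (ε : ℝ) : sunExpDrift (L := ι) pauliCoordι pauliCoordι_skew ε = su2ExpDrift ε := by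
  funext p l
  exact Subtype.ext rfl

/-- At `n = 1` the `SU(N)` proposal map in Pauli coordinates is gen-13's `su2LeapfrogProposal`. -/
theorem sunLeapfrogProposalN_pauli_one (ε : ℝ) (g : (ι → Matrix.specialUnitaryGroup (Fin 2) ℂ) → ι → EuclideanSpace ℝ (Fin 3)) :
    sunLeapfrogProposalN pauliCoordι pauliCoordι_skew ε g 1 = su2LeapfrogProposal ε g := by
  rw [sunLeapfrogProposalN, su2LeapfrogProposal, sunExpDrift_pauliCoordι]

variable [Fintype ι]

/-- The refresh laws agree: `sunMomentumLaw volume (su2Kinetic κ) = su2MomentumLaw κ`. -/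
theorem sunMomentumLaw_pauli (κ : ℝ) :
    sunMomentumLaw (L := ι) (volume : Measure (EuclideanSpace ℝ (Fin 3))) (su2Kinetic κ) = su2MomentumLaw κ := rfl

/-- The momentum weights agree. -/
theorem sunMomentumWeight_pauli (κ : ℝ) :
    sunMomentumWeight (L := ι) (volume : Measure (EuclideanSpace ℝ (Fin 3))) (su2Kinetic κ) = su2MomentumWeight κ := rfl

end Coords

/-! ## §2 The `SU(2)` kernel at `nstep = n` -/

section Kernel

variable {ι : Type*} [Fintype ι] (ε κ : ℝ) {g : (ι → Matrix.specialUnitaryGroup (Fin 2) ℂ) → ι → EuclideanSpace ℝ (Fin 3)}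

/-- A congruence for `involMH` in the map (the kernel does not depend on the measurability proof). -/
theorem involMH_congr_map {X : Type*} [MeasurableSpace X] {Φ Ψ : X → X} (h : Φ = Ψ) (hΦ : Measurable Φ)
    (hΨ : Measurable Ψ) (H : X → ℝ) : involMH Φ hΦ H = involMH Ψ hΨ H := by
  subst h; rfl

/-- **THE ENGINE'S `SU(2)` CONFIGURATION KERNEL AT `nstep = n`** in Pauli coordinates
(`hmc.HMC(f, β, 'leapfrog').trajectory(τ = nε, nstep = n)` on `SU(2)`): refresh `p ∼ Z⁻¹e^{−κΣ|p_l|²}`,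
`n` P-first leapfrog steps with drift `U_l ← exp(iε p_l·σ)U_l`, flip, Metropolis, forget `p`. -/
def su2LeapfrogHMCN (hg : Measurable g) (S : (ι → Matrix.specialUnitaryGroup (Fin 2) ℂ) → ℝ) (n : ℕ) :
    Kernel (ι → Matrix.specialUnitaryGroup (Fin 2) ℂ) (ι → Matrix.specialUnitaryGroup (Fin 2) ℂ) :=
  sunLeapfrogHMCN pauliCoordι pauliCoordι_skew ε (volume : Measure (EuclideanSpace ℝ (Fin 3))) (su2Kinetic κ) hg S n

/-- **At `n = 1` this IS gen-13's single-step kernel `su2LeapfrogHMC ε κ hg S`.** -/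
theorem su2LeapfrogHMCN_one (hg : Measurable g) (S : (ι → Matrix.specialUnitaryGroup (Fin 2) ℂ) → ℝ) :
    su2LeapfrogHMCN ε κ hg S 1 = su2LeapfrogHMC ε κ hg S := by
  unfold su2LeapfrogHMCN sunLeapfrogHMCN su2LeapfrogHMC
  rw [involMH_congr_map (show ⇑(sunLeapfrogProposalN pauliCoordι pauliCoordι_skew ε g 1) = ⇑(su2LeapfrogProposal ε g) by
      rw [sunLeapfrogProposalN_pauli_one])
    (measurable_sunLeapfrogProposalN pauliCoordι pauliCoordι_skew ε 1 hg) (measurable_su2LeapfrogProposal ε hg)]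
  rfl

variable {ε κ}

/-- **Exactness at every `nstep`**: `e^{−S} · Haar^{⊗ι}` is invariant (`κ > 0`, any `ε`, measurable `g`, `S`). -/
theorem su2LeapfrogHMCN_invariant (hκ : 0 < κ) (hg : Measurable g)
    {S : (ι → Matrix.specialUnitaryGroup (Fin 2) ℂ) → ℝ} (hS : Measurable S) (n : ℕ) :
    Invariant (su2LeapfrogHMCN ε κ hg S n)
      ((Measure.pi fun _ : ι => haarProbability (Matrix.specialUnitaryGroup (Fin 2) ℂ)).withDensity
        fun u => ENNReal.ofReal (Real.exp (-S u))) :=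
  sunLeapfrogHMCN_invariant pauliCoordι pauliCoordι_skew hg (measurable_su2Kinetic κ)
    (by rw [sunMomentumWeight_pauli]; exact su2MomentumWeight_univ_ne_top hκ) hS n

end Kernel

/-! ## §3 Uniform ergodicity for short trajectories -/

section Ergodic

variable {ι : Type*} [Fintype ι] {ε κ : ℝ} {g : (ι → Matrix.specialUnitaryGroup (Fin 2) ℂ) → ι → EuclideanSpace ℝ (Fin 3)}
  {S : (ι → Matrix.specialUnitaryGroup (Fin 2) ℂ) → ℝ} {b Kg s : ℝ} {n : ℕ}

/-- The `SU(N)` Gibbs law in these letters is gen-13's `su2GibbsLaw S`. -/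
theorem gibbsProbability_eq_su2GibbsLaw (S : (ι → Matrix.specialUnitaryGroup (Fin 2) ℂ) → ℝ) :
    gibbsProbability (Measure.pi fun _ : ι => haarProbability (Matrix.specialUnitaryGroup (Fin 2) ℂ))
      (fun u => Real.exp (-S u)) = su2GibbsLaw S := rfl

/-- **MULTI-STEP LEAPFROG HMC ON `SU(2)^ι` (PAULI COORDINATES) IS UNIFORMLY ERGODIC FOR SHORT
TRAJECTORIES**: `ε > 0`, `κ > 0`, `n ≥ 1`, a measurable increment bounded by `b ≥ 0` per link and
`K_g`-Lipschitz (`K_g ≥ 0`) in the matrix sup norm, a measurable action bounded by `s`, and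
`nε, (2n+1)b, K_g εn² ≤ sunShortTrajThreshold pauliCoordι _`: there are `k` and `δ ∈ (0, 1]` with
`|μ₀K_nᵗ(A) − su2GibbsLaw S (A)| ≤ (1 − δ)^{⌊t/(k+1)⌋}` for EVERY initial law `μ₀`, every `t`, `A`. -/
theorem su2LeapfrogHMCN_uniformlyErgodic (hε : 0 < ε) (hκ : 0 < κ) (hn : 1 ≤ n) (hg : Measurable g)
    (hb0 : 0 ≤ b) (hb : ∀ u l, ‖g u l‖ ≤ b) (hK0 : 0 ≤ Kg)
    (hK : ∀ U U', ‖g U - g U'‖ ≤ Kg * ‖coeConfig U - coeConfig U'‖) (hS : Measurable S) (hs : ∀ u, |S u| ≤ s)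
    (h1 : n * ε ≤ sunShortTrajThreshold pauliCoordι pauliCoordι_injective)
    (h2 : (2 * n + 1) * b ≤ sunShortTrajThreshold pauliCoordι pauliCoordι_injective)
    (h3 : Kg * ε * (n : ℝ) ^ 2 ≤ sunShortTrajThreshold pauliCoordι pauliCoordι_injective) :
    ∃ k : ℕ, ∃ δ : ℝ, 0 < δ ∧ δ ≤ 1 ∧ ∀ (μ₀ : Measure (ι → Matrix.specialUnitaryGroup (Fin 2) ℂ))
      [IsProbabilityMeasure μ₀] (t : ℕ) (A : Set (ι → Matrix.specialUnitaryGroup (Fin 2) ℂ)),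
      |((fun m : Measure (ι → Matrix.specialUnitaryGroup (Fin 2) ℂ) => m.bind (su2LeapfrogHMCN ε κ hg S n))^[t] μ₀).real A
          - (su2GibbsLaw S).real A| ≤ (1 - δ) ^ (t / (k + 1)) := by
  rw [← gibbsProbability_eq_su2GibbsLaw]
  exact sunLeapfrogHMCN_uniformlyErgodic pauliCoordι pauliCoordι_skew pauliCoordι_injective volume
    (τ := fun R => κ * (Fintype.card ι * R ^ 2)) pauliCoordι_range hε hn (measurable_su2Kinetic κ)
    (su2Kinetic_nonneg hκ.le) (fun R p hp => su2Kinetic_le_of_norm_le hκ.le hp)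
    (by rw [sunMomentumWeight_pauli]; exact su2MomentumWeight_univ_ne_top hκ) hg hb0 hb hK0 hK hS hs h1 h2 h3

/-- **`su2GibbsLaw S` is the unique invariant probability law** of the `n`-step `SU(2)` kernel, for
short trajectories (same hypotheses). -/
theorem su2LeapfrogHMCN_invariant_unique (hε : 0 < ε) (hκ : 0 < κ) (hn : 1 ≤ n) (hg : Measurable g)
    (hb0 : 0 ≤ b) (hb : ∀ u l, ‖g u l‖ ≤ b) (hK0 : 0 ≤ Kg)
    (hK : ∀ U U', ‖g U - g U'‖ ≤ Kg * ‖coeConfig U - coeConfig U'‖) (hS : Measurable S) (hs : ∀ u, |S u| ≤ s)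
    (h1 : n * ε ≤ sunShortTrajThreshold pauliCoordι pauliCoordι_injective)
    (h2 : (2 * n + 1) * b ≤ sunShortTrajThreshold pauliCoordι pauliCoordι_injective)
    (h3 : Kg * ε * (n : ℝ) ^ 2 ≤ sunShortTrajThreshold pauliCoordι pauliCoordι_injective)
    {π' : Measure (ι → Matrix.specialUnitaryGroup (Fin 2) ℂ)} [IsProbabilityMeasure π']
    (hπ' : Invariant (su2LeapfrogHMCN ε κ hg S n) π') :
    π' = su2GibbsLaw S := by
  rw [← gibbsProbability_eq_su2GibbsLaw]
  exact sunLeapfrogHMCN_invariant_unique pauliCoordι pauliCoordι_skew pauliCoordι_injective volume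
    (τ := fun R => κ * (Fintype.card ι * R ^ 2)) pauliCoordι_range hε hn (measurable_su2Kinetic κ)
    (su2Kinetic_nonneg hκ.le) (fun R p hp => su2Kinetic_le_of_norm_le hκ.le hp)
    (by rw [sunMomentumWeight_pauli]; exact su2MomentumWeight_univ_ne_top hκ) hg hb0 hb hK0 hK hS hs h1 h2 h3 hπ'

end Ergodic

end Summit.Ventures.LatticeQCDFlow.Exactness
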